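import Summits.RiemannHypothesis.RiemannHypothesis.Theorems.WeilColumnTruncatedWitness
import Summits.RiemannHypothesis.RiemannHypothesis.Theorems.WeilColumnTruncatedTailCut
import Summits.RiemannHypothesis.RiemannHypothesis.Theorems.WeilColumnTruncationError
import Summits.RiemannHypothesis.RiemannHypothesis.Theorems.WeilColumnThetaCutWitness
import Summits.RiemannHypothesis.RiemannHypothesis.Theorems.WeilColumnTruncatedTailNormA
import Literature.NumberTheory.LFunctions.WeilMellinInversion
import HarnessLib

/-!
# THETA kernel certificate, (P_R) Step 3: the zero-side decay of the truncated tail `T_R`, UNIFORM IN `R` (RH-FREE)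

Cell `rh-explicit`, WEIL column, seat weil-1 gen19 (director-rh ruling 2026-08-26T07:10Z «GO Step 3+6»; THETA-ASSIGN v1.1 §6
Step 3). In the full-form assembly (P_R) the witness is split as `g⁻ = G_R⁻ − T_R⁻` with `T_R = G₀·ψ_R·(1 − χ)`
(`WeilColumnTruncatedWitness`: `ψ_R = smoothStep R`); the «bracket» of Step 4 is `O(W_R·W_T)` with `W_R → 0`
(`WeilColumnTruncationError`) PROVIDED the zero-side decay constant `W_T` of `T_R` does not depend on `R`. This file proves it:

* §1 the smooth step: `HasDerivAt (smoothStep R) (deriv smoothTransition (x + R + 1)) x`, continuity of that derivative, and a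
  UNIVERSAL bound `∃ L ≥ 0, ∀ y, |deriv smoothTransition y| ≤ L`;
* §2 `T_R = expProfile Θ·(1 − χ̃_R)` (handoff-prove-2's `TR_eq_tail`) with the combined cut `χ̃_R = truncCut ψ_R χ` (`WeilColumnTruncatedTailCut`), which is a cut in
  the lane's sense for EVERY `R`: values in `[0,1]`, `= 1` on `[x₁, ∞)`, `C¹` with `|χ̃_R′| ≤ L + m/η`; `T_R` is continuous with
  compact support (`⊆ [−R−1, x₁]`);
* §3 **`exists_norm_weilMellin_TR_le`**: under the D2 hypotheses of the lane (`HasDerivAt Θ`, `‖uΘ′(u)‖ ≤ M₁(u/u₁)^{m−1}` on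
  `(0, u₁]`, `Θ′` continuous on `(0,∞)`) there is `W ≥ 0` with `‖T̂_R(s)‖ ≤ W/‖s − ½‖` for ALL `R` and all `s ≠ ½`, `Re s ≥ 0`
  (cc-s2-3's `norm_weilMellin_truncError_le` applied with the step `χ̃_R` and `R := −x₁`); hence the same for the odd part
  `T_R⁻` on `0 ≤ Re s ≤ 1` (`exists_norm_weilMellin_TROdd_le`) and for its mollification `T_R⁻ ⋆ moll_k`, uniformly in `R`
  AND `k` (`exists_norm_weilMellin_TROdd_moll_le`; `‖m̂oll_k(s)‖ ≤ e^{1/2}`).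

Upper-clause bookkeeping only; nothing here bears on the truth of RH.
-/

noncomputable section

set_option linter.dupNamespace false

open Complex Set MeasureTheory Filter
open scoped Real Topology ComplexConjugate

namespace Summit.RiemannHypothesis.RiemannHypothesis.Theorems.WeilColumn.ThetaMellin

open Literature.NumberTheory.LFunctions Literature.NumberTheory.LFunctions.WeilContinuous ThetaParams

/-! ## §1 The smooth step `ψ_R(x) = smoothTransition(x + R + 1)` -/

/-- `ψ_R′(x) = smoothTransition′(x + R + 1)`. [folklore] -/
theorem hasDerivAt_smoothStep (R x : ℝ) : HasDerivAt (smoothStep R) (deriv Real.smoothTransition (x + R + 1)) x := by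
  have h1 : HasDerivAt Real.smoothTransition (deriv Real.smoothTransition (x + R + 1)) (x + R + 1) :=
    ((Real.smoothTransition.contDiffAt (n := 1)).differentiableAt one_ne_zero).hasDerivAt
  have h2 : HasDerivAt (fun x : ℝ ↦ x + R + 1) 1 x := by
    simpa using ((hasDerivAt_id x).add_const R).add_const (1 : ℝ)
  have h := h1.comp x h2
  rw [mul_one] at h
  exact h

/-- `x ↦ ψ_R′(x)` is continuous (`smoothTransition` is `C^∞`; cf. `Literature.Analysis.FluidPDE.continuous_deriv_smoothTransition`). [folklore] -/
theorem continuous_deriv_smoothStep (R : ℝ) : Continuous fun x : ℝ ↦ deriv Real.smoothTransition (x + R + 1) :=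
  ((Real.smoothTransition.contDiff (n := 1)).continuous_deriv le_rfl).comp
    ((continuous_id.add continuous_const).add continuous_const)

/-- **A universal bound for the step's derivative**: `∃ L ≥ 0, ∀ y, |smoothTransition′(y)| ≤ L` (continuous, and `0` off `[0,1]`
where the step is locally constant; cf. `Literature.Analysis.FluidPDE.deriv_smoothTransition_eq_zero`). [folklore] -/
theorem exists_abs_deriv_smoothTransition_le : ∃ L : ℝ, 0 ≤ L ∧ ∀ y : ℝ, |deriv Real.smoothTransition y| ≤ L := by
  have hcont : Continuous (deriv Real.smoothTransition) := (Real.smoothTransition.contDiff (n := 1)).continuous_deriv le_rfl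
  obtain ⟨C, hC⟩ := isCompact_Icc.exists_bound_of_continuousOn (hcont.continuousOn (s := Icc (0 : ℝ) 1))
  refine ⟨max C 0, le_max_right _ _, fun y ↦ ?_⟩
  by_cases hy : y ∈ Icc (0 : ℝ) 1
  · exact ((Real.norm_eq_abs _).symm.le.trans (hC y hy)).trans (le_max_left _ _)
  · -- off `[0,1]` the step is locally constant, so its derivative vanishes
    have hzero : deriv Real.smoothTransition y = 0 := by
      rw [mem_Icc, not_and_or, not_le, not_le] at hy
      rcases hy with hy | hy
      · have hev : Real.smoothTransition =ᶠ[𝓝 y] fun _ ↦ (0 : ℝ) := by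
          filter_upwards [Iio_mem_nhds hy] with z hz using Real.smoothTransition.zero_of_nonpos (le_of_lt hz)
        rw [hev.deriv_eq, deriv_const]
      · have hev : Real.smoothTransition =ᶠ[𝓝 y] fun _ ↦ (1 : ℝ) := by
          filter_upwards [Ioi_mem_nhds hy] with z hz using Real.smoothTransition.one_of_one_le (le_of_lt hz)
        rw [hev.deriv_eq, deriv_const]
    rw [hzero, abs_zero]; exact le_max_right _ _

namespace ThetaParams

variable {P : ThetaParams}

/-! ## §2 `T_R` is a tail with the combined cut `χ̃_R = 1 − ψ_R(1 − χ)` -/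

/-- `1 ≤ m` for an admissible row. -/
private theorem one_le_m₃ {qn : ℕ} (hP : P.Admissible qn) : 1 ≤ P.m := le_trans (by norm_num) hP.three_le

/-- `2 ≤ m` for an admissible row. -/
private theorem two_le_m₃ {qn : ℕ} (hP : P.Admissible qn) : 2 ≤ P.m := le_trans (by norm_num) hP.three_le

/-- `T_R` as a function: `P.TR R = fun x ↦ expProfile Θ x·(1 − χ̃_R x)` (pointwise: handoff-prove-2's `TR_eq_tail`). [folklore] -/
theorem TR_eq_tail_fun (P : ThetaParams) (R : ℝ) :
    P.TR R = fun x ↦ expProfile P.Θ x * (((1 - truncCut (smoothStep R) P.cut x : ℝ)) : ℂ) :=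
  funext (P.TR_eq_tail R)

/-- `χ̃_R ∈ [0, 1]`. [folklore] -/
theorem truncCut_cut_mem_Icc {qn : ℕ} (hP : P.Admissible qn) (R x : ℝ) :
    truncCut (smoothStep R) P.cut x ∈ Icc (0 : ℝ) 1 :=
  truncCut_mem_Icc (smoothStep_mem_Icc R) (P.cut_mem_Icc hP.eta_pos (one_le_m₃ hP)) x

/-- `χ̃_R = 1` on `[x₁, ∞)` (where `χ = 1`), for EVERY `R`. [folklore] -/
theorem truncCut_cut_eq_one {qn : ℕ} (hP : P.Admissible qn) (R : ℝ) {x : ℝ} (hx : P.x₁ ≤ x) :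
    truncCut (smoothStep R) P.cut x = 1 :=
  truncCut_eq_one (ψ := smoothStep R) (fun _ hy ↦ P.cut_eq_one hP.eta_pos (one_le_m₃ hP) hy) hx

/-- The derivative of `χ̃_R`. [folklore] -/
theorem hasDerivAt_truncCut_cut {qn : ℕ} (hP : P.Admissible qn) (R x : ℝ) :
    HasDerivAt (truncCut (smoothStep R) P.cut)
      (-(deriv Real.smoothTransition (x + R + 1) * (1 - P.cut x)) +
        smoothStep R x * (bsplineDensity (P.η / (2 * P.m)) (P.m - 1) (x + P.a - P.η / 2)).re) x :=
  hasDerivAt_truncCut (ψ := smoothStep R) (χ := P.cut) (fun y ↦ hasDerivAt_smoothStep R y)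
    (fun y ↦ P.hasDerivAt_cut hP.eta_pos (two_le_m₃ hP) y) x

/-- `|χ̃_R′| ≤ L + m/η` when `|smoothTransition′| ≤ L`. [folklore] -/
theorem abs_deriv_truncCut_cut_le {qn : ℕ} (hP : P.Admissible qn) {L : ℝ} (hL : ∀ y, |deriv Real.smoothTransition y| ≤ L)
    (R x : ℝ) :
    |-(deriv Real.smoothTransition (x + R + 1) * (1 - P.cut x)) +
        smoothStep R x * (bsplineDensity (P.η / (2 * P.m)) (P.m - 1) (x + P.a - P.η / 2)).re| ≤ L + P.m / P.η :=
  abs_deriv_truncCut_le (ψ := smoothStep R) (χ := P.cut) (ψ' := fun y ↦ deriv Real.smoothTransition (y + R + 1))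
    (χ' := fun y ↦ (bsplineDensity (P.η / (2 * P.m)) (P.m - 1) (y + P.a - P.η / 2)).re)
    (smoothStep_mem_Icc R) (P.cut_mem_Icc hP.eta_pos (one_le_m₃ hP)) (fun _ ↦ hL _)
    (fun y ↦ P.abs_cut_deriv_le hP.eta_pos (two_le_m₃ hP) y) x

/-- `χ̃_R′` is continuous. [folklore] -/
theorem continuous_deriv_truncCut_cut {qn : ℕ} (hP : P.Admissible qn) (R : ℝ) :
    Continuous fun x ↦ -(deriv Real.smoothTransition (x + R + 1) * (1 - P.cut x)) +
      smoothStep R x * (bsplineDensity (P.η / (2 * P.m)) (P.m - 1) (x + P.a - P.η / 2)).re := by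
  have hc : 0 < P.η / (2 * P.m) := P.cut_scale_pos hP.eta_pos (one_le_m₃ hP)
  exact continuous_deriv_truncCut (ψ := smoothStep R) (χ := P.cut) (continuous_smoothStep R)
    (continuous_deriv_smoothStep R) (continuous_cut hP.eta_pos (two_le_m₃ hP))
    ((continuous_bsplineDensity_re hc (by have := two_le_m₃ hP; omega)).comp
      ((continuous_id.add continuous_const).sub continuous_const))

/-- `T_R` is continuous. [folklore] -/
theorem continuous_TR {qn : ℕ} (hP : P.Admissible qn) (R : ℝ) : Continuous (P.TR R) := by
  show Continuous fun x ↦ P.G₀ x * (smoothStep R x : ℂ) * (((1 - P.cut x : ℝ)) : ℂ)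
  exact ((continuous_G₀ hP).mul (Complex.continuous_ofReal.comp (continuous_smoothStep R))).mul
    (Complex.continuous_ofReal.comp (continuous_const.sub (continuous_cut hP.eta_pos (two_le_m₃ hP))))

/-- `T_R = 0` on `[x₁, ∞)` (the cut is `1` there). [folklore] -/
theorem TR_eq_zero_of_ge {qn : ℕ} (hP : P.Admissible qn) (R : ℝ) {x : ℝ} (hx : P.x₁ ≤ x) : P.TR R x = 0 := by
  rw [TR, P.cut_eq_one hP.eta_pos (one_le_m₃ hP) hx]; simp

/-- `T_R` has compact support (`⊆ [−R−1, x₁]`). [folklore] -/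
theorem hasCompactSupport_TR {qn : ℕ} (hP : P.Admissible qn) (R : ℝ) : HasCompactSupport (P.TR R) := by
  refine HasCompactSupport.of_support_subset_isCompact (isCompact_Icc (a := -R - 1) (b := P.x₁)) fun x hx ↦ ?_
  rw [Function.mem_support] at hx
  by_contra h
  rw [mem_Icc, not_and_or, not_le, not_le] at h
  rcases h with h | h
  · exact hx (P.TR_eq_zero_of_le (R := R) h.le)
  · exact hx (TR_eq_zero_of_ge hP R h.le)

/-- `T_R⁻` is continuous. [folklore] -/
theorem continuous_TROdd {qn : ℕ} (hP : P.Admissible qn) (R : ℝ) : Continuous (P.TROdd R) := by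
  show Continuous fun x ↦ P.TR R x - P.TR R (-x)
  exact (continuous_TR hP R).sub ((continuous_TR hP R).comp continuous_neg)

/-- `T_R⁻` has compact support. [folklore] -/
theorem hasCompactSupport_TROdd {qn : ℕ} (hP : P.Admissible qn) (R : ℝ) : HasCompactSupport (P.TROdd R) := by
  show HasCompactSupport fun x ↦ P.TR R x - P.TR R (-x)
  exact (hasCompactSupport_TR hP R).sub ((hasCompactSupport_TR hP R).comp_homeomorph (Homeomorph.neg ℝ))

/-! ## §3 The R-uniform zero-side decay of `T_R`, `T_R⁻`, `T_R⁻ ⋆ moll_k` -/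

/-- `0 ≤ M`. -/
private theorem M_nonneg₃ {qn : ℕ} (hP : P.Admissible qn) : 0 ≤ P.M := by
  have h := le_trans (norm_nonneg _) (P.norm_Θ_le' hP Real.zero_lt_one)
  have hc : 0 < (1 / P.u₁) ^ P.m := by have : 0 < P.u₁ := Real.exp_pos _; positivity
  exact le_of_mul_le_mul_right (by rwa [zero_mul]) hc

/-- `0 ≤ M₁` follows from the D2 majorant at `u = u₁`. -/
private theorem M₁_nonneg_of_hyp {Θ' : ℝ → ℂ}
    (hM₁ : ∀ u ∈ Ioc (0 : ℝ) P.u₁, ‖(u : ℂ) * Θ' u‖ ≤ P.M₁ * (u / P.u₁) ^ (P.m - 1)) : 0 ≤ P.M₁ := by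
  have hu : 0 < P.u₁ := Real.exp_pos _
  have h := hM₁ P.u₁ ⟨hu, le_rfl⟩
  rw [div_self hu.ne', one_pow, mul_one] at h
  exact (norm_nonneg _).trans h

/-- **STEP 3 (R-UNIFORM ZERO-SIDE DECAY OF THE TRUNCATED TAIL).** Under the lane's D2 hypotheses there is `W ≥ 0`, INDEPENDENT
of `R`, with `‖T̂_R(s)‖ ≤ W/‖s − ½‖` for every `R` and every `s ≠ ½` with `Re s ≥ 0` — cc-s2-3's `norm_weilMellin_truncError_le`
for the step `χ̃_R` (a cut for every `R`: `= 1` on `[x₁,∞)`, `|χ̃_R′| ≤ L + m/η`) at `R := −x₁`. [THETA-ASSIGN v1.1 §6 Step 3] -/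
theorem exists_norm_weilMellin_TR_le {qn : ℕ} (hP : P.Admissible qn) {Θ' : ℝ → ℂ}
    (hΘ' : ∀ u : ℝ, 0 < u → HasDerivAt P.Θ (Θ' u) u) (hΘ'c : ContinuousOn Θ' (Ioi 0))
    (hM₁ : ∀ u ∈ Ioc (0 : ℝ) P.u₁, ‖(u : ℂ) * Θ' u‖ ≤ P.M₁ * (u / P.u₁) ^ (P.m - 1)) :
    ∃ W : ℝ, 0 ≤ W ∧ ∀ (R : ℝ) (s : ℂ), 0 ≤ s.re → s ≠ 1 / 2 → ‖weilMellin (P.TR R) s‖ ≤ W / ‖s - 1 / 2‖ := by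
  obtain ⟨L, hL0, hL⟩ := exists_abs_deriv_smoothTransition_le
  have hm : 2 ≤ P.m := two_le_m₃ hP
  have hx₁ : P.x₁ < 0 := P.x₁_neg hP
  have hM0 := M_nonneg₃ hP
  have hM₁0 := M₁_nonneg_of_hyp hM₁
  have hm0 : (0 : ℝ) < P.m := Nat.cast_pos.2 (by omega)
  have hLtot : 0 ≤ L + P.m / P.η := by have := hP.eta_pos; positivity
  -- the R-free constant of `norm_weilMellin_truncError_le` at `R := −x₁`
  set W : ℝ := (((3 / 2 + (L + P.m / P.η)) * P.M) / P.u₁ ^ P.m + P.M₁ / P.u₁ ^ (P.m - 1)) *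
      Real.exp ((((P.m : ℝ) - 1 / 2) - 1 / 2) * (-(-P.x₁))) / (((P.m : ℝ) - 1 / 2) - 1 / 2) with hW
  have hu₁ : 0 < P.u₁ := Real.exp_pos _
  have hW0 : 0 ≤ W := by
    have hden : 0 < ((P.m : ℝ) - 1 / 2) - 1 / 2 := by
      have : (2 : ℝ) ≤ P.m := by exact_mod_cast hm
      linarith
    rw [hW]; positivity
  refine ⟨W, hW0, fun R s hs0 hs ↦ ?_⟩
  rw [TR_eq_tail_fun P R]
  have h := norm_weilMellin_truncError_le (Θ := P.Θ) (Θ' := Θ') (ψ := truncCut (smoothStep R) P.cut)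
    (ψ' := fun x ↦ -(deriv Real.smoothTransition (x + R + 1) * (1 - P.cut x)) +
      smoothStep R x * (bsplineDensity (P.η / (2 * P.m)) (P.m - 1) (x + P.a - P.η / 2)).re)
    (M := P.M) (M₁ := P.M₁) (Lψ := L + P.m / P.η) (u₁ := P.u₁) (x₁ := P.x₁) (R := -P.x₁) (m := P.m)
    hm rfl (by linarith) (by linarith) hx₁.le hΘ' hΘ'c (fun u hu ↦ P.norm_Θ_le' hP hu.1) hM₁ hM0 hM₁0
    (truncCut_cut_mem_Icc hP R) (fun x hx ↦ truncCut_cut_eq_one hP R (by linarith)) (hasDerivAt_truncCut_cut hP R)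
    (continuous_deriv_truncCut_cut hP R) (abs_deriv_truncCut_cut_le hP hL R) hLtot hs0 hs
  rw [hW]
  exact h

/-- `‖(1 − s) − ½‖ = ‖s − ½‖`. [folklore] -/
theorem norm_one_sub_sub_half (s : ℂ) : ‖(1 - s) - 1 / 2‖ = ‖s - 1 / 2‖ := by
  rw [show (1 : ℂ) - s - 1 / 2 = -(s - 1 / 2) by ring, norm_neg]

/-- **The odd truncated tail `T_R⁻` decays on the zero side uniformly in `R`**: `∃ W ≥ 0, ∀ R, ‖(T_R⁻)^(s)‖ ≤ W/‖s − ½‖` for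
`0 ≤ Re s ≤ 1`, `s ≠ ½` (`(T_R(−·))^(s) = T̂_R(1 − s)`). [THETA-ASSIGN v1.1 §6 Step 3] -/
theorem exists_norm_weilMellin_TROdd_le {qn : ℕ} (hP : P.Admissible qn) {Θ' : ℝ → ℂ}
    (hΘ' : ∀ u : ℝ, 0 < u → HasDerivAt P.Θ (Θ' u) u) (hΘ'c : ContinuousOn Θ' (Ioi 0))
    (hM₁ : ∀ u ∈ Ioc (0 : ℝ) P.u₁, ‖(u : ℂ) * Θ' u‖ ≤ P.M₁ * (u / P.u₁) ^ (P.m - 1)) :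
    ∃ W : ℝ, 0 ≤ W ∧ ∀ (R : ℝ) (s : ℂ), 0 ≤ s.re → s.re ≤ 1 → s ≠ 1 / 2 →
      ‖weilMellin (P.TROdd R) s‖ ≤ W / ‖s - 1 / 2‖ := by
  obtain ⟨W, hW0, hW⟩ := exists_norm_weilMellin_TR_le hP hΘ' hΘ'c hM₁
  refine ⟨2 * W, by positivity, fun R s hs0 hs1 hs ↦ ?_⟩
  have hc := continuous_TR hP R
  have hcs := hasCompactSupport_TR hP R
  have e : P.TROdd R = P.TR R - fun x ↦ P.TR R (-x) := by
    funext x; rfl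
  have hc' : Continuous fun x ↦ P.TR R (-x) := hc.comp continuous_neg
  have hcs' : HasCompactSupport fun x ↦ P.TR R (-x) := hcs.comp_homeomorph (Homeomorph.neg ℝ)
  rw [e, weilMellin_sub hc hcs hc' hcs', weilMellin_comp_neg]
  have h1 := hW R s hs0 hs
  have h2 := hW R (1 - s) (by simp; linarith) (by intro h; apply hs; linear_combination (-1 : ℂ) * h)
  rw [norm_one_sub_sub_half] at h2
  calc ‖weilMellin (P.TR R) s - weilMellin (P.TR R) (1 - s)‖
      ≤ ‖weilMellin (P.TR R) s‖ + ‖weilMellin (P.TR R) (1 - s)‖ := norm_sub_le _ _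
    _ ≤ W / ‖s - 1 / 2‖ + W / ‖s - 1 / 2‖ := add_le_add h1 h2
    _ = 2 * W / ‖s - 1 / 2‖ := by ring

/-- **… and so does its mollification `T_R⁻ ⋆ moll_k`, uniformly in `R` and `k`** (`(f ⋆ moll_k)^ = f̂·m̂oll_k`,
`‖m̂oll_k(s)‖ ≤ e^{|Re s − ½|} ≤ e^{1/2}`). [THETA-ASSIGN v1.1 §6 Step 3] -/
theorem exists_norm_weilMellin_TROdd_moll_le {qn : ℕ} (hP : P.Admissible qn) {Θ' : ℝ → ℂ}
    (hΘ' : ∀ u : ℝ, 0 < u → HasDerivAt P.Θ (Θ' u) u) (hΘ'c : ContinuousOn Θ' (Ioi 0))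
    (hM₁ : ∀ u ∈ Ioc (0 : ℝ) P.u₁, ‖(u : ℂ) * Θ' u‖ ≤ P.M₁ * (u / P.u₁) ^ (P.m - 1)) :
    ∃ W : ℝ, 0 ≤ W ∧ ∀ (R : ℝ) (k : ℕ) (s : ℂ), 0 ≤ s.re → s.re ≤ 1 → s ≠ 1 / 2 →
      ‖weilMellin (weilConv (P.TROdd R) (moll k)) s‖ ≤ W / ‖s - 1 / 2‖ := by
  obtain ⟨W, hW0, hW⟩ := exists_norm_weilMellin_TROdd_le hP hΘ' hΘ'c hM₁
  refine ⟨W * Real.exp (1 / 2), by positivity, fun R k s hs0 hs1 hs ↦ ?_⟩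
  rw [weilMellin_weilConv_moll (continuous_TROdd hP R) (hasCompactSupport_TROdd hP R) k s, norm_mul]
  have hmoll : ‖weilMellin (moll k) s‖ ≤ Real.exp (1 / 2) := by
    refine (norm_weilMellin_moll_le k s).trans (Real.exp_le_exp.2 ?_)
    rw [abs_le]; constructor <;> linarith
  have hpos : 0 < ‖s - 1 / 2‖ := norm_pos_iff.2 (sub_ne_zero.2 hs)
  calc ‖weilMellin (P.TROdd R) s‖ * ‖weilMellin (moll k) s‖
      ≤ W / ‖s - 1 / 2‖ * Real.exp (1 / 2) :=
        mul_le_mul (hW R s hs0 hs1 hs) hmoll (norm_nonneg _) (div_nonneg hW0 hpos.le)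
    _ = W * Real.exp (1 / 2) / ‖s - 1 / 2‖ := by ring

end ThetaParams

end Summit.RiemannHypothesis.RiemannHypothesis.Theorems.WeilColumn.ThetaMellin

end
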